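import Summits.CriticalPhenomena.CardyFormulaZ2.Theses.CardyBoundaryCoulombGas
import Summits.CriticalPhenomena.CardyFormulaZ2.Theses.CardyMonotoneApproach
import Summits.CriticalPhenomena.CardyFormulaZ2.Theorems.RectilinearCardy.Negative.RectilinearCardySquareInstance
import Literature.Probability.Percolation.Crossings
import Literature.Probability.LatticeModels.DomainDiscretisation
import Literature.Probability.LatticeModels.DirichletGreenFunction

/-!
# Line `rank-one-ward-carving` — skeleton for crux `RectilinearCardy` (stmt-CriticalPhenomena-5660)

Crux (route `CardyBoundaryCoulombGas`, rank 4): Cardy's formula for bond-`ℤ²` at `p = 1/2` for every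
conformal rectangle whose Jordan boundary lies in finitely many axis-parallel segments
(`RectilinearCardy`; `Negative.rectilinearCardy_iff` = `Iff.rfl`).

Idea (card `Ideas/rank-one-ward-carving.md`, crux-ideate r1 ideator 3; triage r1-1/2/3: pass ×3 with one
mandatory sharpening, built in below). Two EXACT rank-one identities on a lattice polygon: Russo for
deleting one boundary vertex (the crossing probability moves by a one-term pivotal increment, order
`δ²` by the universal half-plane 3-arm exponent) and the Schur complement for killing the walk at that
vertex (the killed Green function, hence the INTRINSIC predictor `F(η_V)`,
`η_V² = G_V(a,c)G_V(b,d)/(G_V(a,b)G_V(c,d))`, moves by an explicit rank-one factor whose continuum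
shadow is the boundary stress-tensor Ward kernel). The line postulates that the two increments agree to
relative `o(1)` — the RANK-ONE WARD IDENTITY — in the SEQUENTIAL flat-step geometry that a row sweep
actually uses (triage r1-1/2/3: the isolated-notch version `RankOneWardBox` with constant `1` is an
unforced identity between two lattice constants and is numerically off by a factor ≈ 1.4–1.6; the
sequential step version is calibrated to constant `1` by the exact row sum rule + rectangle Cardy), and
CARVES: every rectilinear conformal rectangle is reached from a corner-marked lattice rectangle — the
Kleban–Zagier / Bollobás–Riordan family, i.e. the sibling item `CardyMonotoneApproach.RectCardy`
(stmt-CriticalPhenomena-5843), consumed BY NAME as the hypothesis of `RectilinearCardy_of` — by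
`O(δ⁻²)` single boundary-vertex deletions and `O(δ⁻¹)` single-step mark slides, summing exact
increments on the percolation side against exact increments of `F(η_V)` on the Green side.

Objects. Intermediate domains are genuine `ConformalRectangle`s `R'` (so every probability below is
the tree's own `bondDomainCrossingProb R' δ`, discrete arcs by the tree's closest-arc rule); the four
mark VERTICES `m : Fin 4 → Site 2` are carried as data (`MarksNear`: mesh vertices within `2δ` of the
marked points); the predictor is `etaMesh R' δ m` (excursion cross-ratio of the tree's Dirichlet Green
function `dirichletGreen` of the finite mesh domain) and the DEFECT is `defect R' δ m = bondDomainCrossingProb R' δ - F(etaMesh R' δ m)`.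

Stubs (registered; `sorry` only there):
* `stub_excursionModulus` — Kozdron–Lawler: `etaMesh → crossRatio`, uniformly over admissible marks
  (TRUE; discrete potential theory, XL; shared with the sibling line `excursion-cross-ratio`).
* `stub_boxStartDefect` — `BaseDefect → BoxStartDefect`: exact lattice-isometry hygiene (TRUE, M).
* `stub_wardStepLaw` — THE LEVER (open): sequential rank-one Ward identity at `ε`-flat steps, marks
  `ε`-far, additive slack `ε·δ²`, uniform over rectilinear conformal rectangles in a bounded region.
* `stub_markSlideLaw` — its mark-slide twin (open; = the one-step integrated exit density, the
  (1,1,1;3) member of the route's engine read intrinsically), slack `ε·δ`.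
* `stub_canonicalCarving` — existence of carving chains from a lattice-isometric image of a
  Bollobás–Riordan box to `R`: flat steps classified at a flatness scale `ρ(γ)`, predicted variation
  `≤ C`, exceptional steps (row ends, corners, `ρ`-neighbourhoods of marks) of total defect-variation
  `≤ γ` (TRUE; grid shelling of the pockets + a-priori RSW / kernel bounds, L).
Proved here (no `sorry`): `carvingTransfer` — THE CARVING CALCULUS: box-start defects + the two laws +
the canonical carving ⟹ `IntrinsicDefectVanishes`, by telescoping along the chains with the explicit
choice `ε = min (α/(4C)) (min ρ c)` (`abs_sub_le_sum_steps`, `IsFlatStep.anti`); `baseDefect_of_rectCardy`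
(RectCardy + Kozdron–Lawler ⇒ the base family has uniformly vanishing defect, `defect_small_of_tendsto`);
and the composition `RectilinearCardy_of (hRect : RectCardy) : RectilinearCardy`
(`tendsto_of_defect_small`: small defects + Kozdron–Lawler + continuity of `F` on `(0,1)` ⇒ the crossing
limit at every uniformizing datum), which concludes the crux BY NAME. The only hypothesis, `RectCardy`,
is the registered sibling item stmt-CriticalPhenomena-5843.

Disproof.lean (cdisprove v3, read 2026-08-16T04:30Z): no `_false_without_` theorem, no Targets; §4
`rectCardy_of_crux` (crux ⇒ `RectCardy`) — this line runs the converse direction, so its base is a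
NECESSARY consequence of the crux, never a costume; §6 `exists_isRectilinear_modulus_eq` (rectangles
realise every modulus) — the base family is rich enough; §1/§2 (`rectilinearCardy_iff`,
`hasCrossingLimit_iff_tendsto`) are the glue used in `RectilinearCardy_of`. Landed Negative lemmas
(`Theorems/RectilinearCardy/Negative/*`) are IMPORTED; no stub is an instance of anything they refute
(they refute nothing: §3 no-junk, §4 symmetric instances are consequences).
-/

noncomputable section

open Filter Topology Set
open scoped BigOperators
open UpperHalfPlane (upperHalfPlaneSet)
open Literature.Probability.LatticeModels
open Literature.Probability.Percolation (bondDomainCrossingProb)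
open Literature.Probability.RandomPlanarGeometry
open Summit.CriticalPhenomena.CardyFormulaZ2.Theorems.RectilinearCardy.Negative
  (IsRectilinear rectilinearCardy_iff isRectilinear_of_carrier_eq)
open Summit.CriticalPhenomena.CardyFormulaZ2.Theses.CardyBoundaryCoulombGas (RectilinearCardy)
open Summit.CriticalPhenomena.CardyFormulaZ2.Theses.CardyMonotoneApproach (RectCardy)

namespace Summit.CriticalPhenomena.CardyFormulaZ2.Cruxes.RectilinearCardy.RankOneWardCarving

/-! ## §0 Vocabulary: the intrinsic predictor, clean discretisations, flat steps, elementary moves -/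

/-- The DISCRETE EXCURSION CROSS-RATIO of four mark vertices `m 0, …, m 3` of the finite vertex set
`V ⊆ ℤ²`: `η_V(m) = √(G_V(m₀,m₂)G_V(m₁,m₃)/(G_V(m₀,m₁)G_V(m₂,m₃)))`, with `G_V = dirichletGreen V` the
tree's Dirichlet Green function (`= M_V⁻¹`, `M_V = 4·1 - A_V`, i.e. `1/4` of the Green function of
simple random walk killed on leaving `V`; invertibility, symmetry, positivity proved in the tree —
the factor `1/4` cancels). Every lattice-local normalisation of `G_V` at a mark appears once upstairs
and once downstairs and cancels; continuum shadow `crossRatio² = H_ac H_bd/(H_ab H_cd)` for the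
excursion Poisson kernel `H`. The Schur-complement identity
`G_{V∖v}(x,y) = G_V(x,y) - G_V(x,v)G_V(v,y)/G_V(v,v)` is the Green side of the lever. Same object as
the sibling line's `excursionKernel` (`excursion-kernel-covariance`). -/
def excursionEta (V : Finset (Site 2)) (m : Fin 4 → Site 2) : ℝ :=
  Real.sqrt (dirichletGreen V (m 0) (m 2) * dirichletGreen V (m 1) (m 3) /
    (dirichletGreen V (m 0) (m 1) * dirichletGreen V (m 2) (m 3)))

/-- The tree's discrete domain `Ω_δ` of a conformal rectangle as a `Finset` (finite for `δ > 0` by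
`meshDomain_finite`; junk `∅` for `δ ≤ 0`); verbatim the sibling line's `domainFinset`. -/
def domainFinset (R : ConformalRectangle) (δ : ℝ) : Finset (Site 2) :=
  if h : 0 < δ then (meshDomain_finite (Ω := R.carrier) R.isBounded h).toFinset else ∅

/-- The intrinsic predictor argument: excursion cross-ratio of the marks `m` in the discrete domain of
`R` at mesh `δ`. -/
def etaMesh (R : ConformalRectangle) (δ : ℝ) (m : Fin 4 → Site 2) : ℝ :=
  excursionEta (domainFinset R δ) m

/-- The DEFECT of `(R; m)` at mesh `δ`: the tree's crossing probability minus Cardy's function of the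
intrinsic predictor. The whole line is bookkeeping of how this quantity moves under elementary moves. -/
def defect (R : ConformalRectangle) (δ : ℝ) (m : Fin 4 → Site 2) : ℝ :=
  bondDomainCrossingProb R δ - cardyFunction (etaMesh R δ m)

/-- Admissible mark vertices: `m i` is a vertex of the discrete domain within `2δ` of the marked point
`R.pt i` (corners, convex or reflex, included). -/
def MarksNear (R : ConformalRectangle) (δ : ℝ) (m : Fin 4 → Site 2) : Prop :=
  ∀ i, m i ∈ meshDomain R.carrier δ ∧ dist (meshPoint δ (m i)) (R.pt i) ≤ 2 * δ

/-- CLEAN discretisation at mesh `δ`: every mesh vertex belongs to the discrete domain, the discrete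
domain is connected, and every `ℤ²`-edge between two of its vertices is an edge of `Ω_δ` (no slit /
thin-fjord effects at this mesh). Automatic for a fixed rectilinear Jordan polygon once `δ` is below
its feature size; imposed on every intermediate domain of a carving. -/
def CleanAt (Ω : Set ℂ) (δ : ℝ) : Prop :=
  meshDomain Ω δ = meshVertices Ω δ ∧
  (∀ x ∈ meshDomain Ω δ, ∀ y ∈ meshDomain Ω δ, (discreteDomainGraph Ω δ).Reachable x y) ∧
  ∀ x ∈ meshDomain Ω δ, ∀ y ∈ meshDomain Ω δ, (zdGraph 2).Adj x y → (discreteDomainGraph Ω δ).Adj x y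

/-- Integer dot product on `ℤ²`. -/
def dotZ (x y : Site 2) : ℤ := x 0 * y 0 + x 1 * y 1

/-- An oriented lattice frame: two orthogonal unit axis vectors (8 choices = the dihedral group). -/
def IsFrame (e₁ e₂ : Site 2) : Prop :=
  |e₁ 0| + |e₁ 1| = 1 ∧ |e₂ 0| + |e₂ 1| = 1 ∧ dotZ e₁ e₂ = 0

/-- `v` is an `r`-FLAT STEP of the vertex set `W`: inside the sup-ball of radius `r` about `v`, `W` is
exactly a discrete half-plane `{⟪x - v, e₂⟫ < 0}` plus the half-row `{⟪x - v, e₂⟫ = 0, ⟪x - v, e₁⟫ ≥ 0}`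
starting at `v` — the local picture at the moving step of a row sweep (the only bulk local type the
canonical carving uses; never an isolated notch). -/
def IsFlatStep (W : Set (Site 2)) (v : Site 2) (r : ℕ) : Prop :=
  ∃ e₁ e₂ : Site 2, IsFrame e₁ e₂ ∧ ∀ x : Site 2, |x 0 - v 0| ≤ (r : ℤ) → |x 1 - v 1| ≤ (r : ℤ) →
    (x ∈ W ↔ dotZ (x - v) e₂ < 0 ∨ (dotZ (x - v) e₂ = 0 ∧ 0 ≤ dotZ (x - v) e₁))

/-- `u` is an `r`-FLAT boundary vertex of `W`: inside the sup-ball of radius `r` about `u`, `W` is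
exactly the discrete closed half-plane `{⟪x - u, e₂⟫ ≤ 0}` (the local picture at a sliding mark). -/
def IsFlatAt (W : Set (Site 2)) (u : Site 2) (r : ℕ) : Prop :=
  ∃ e₁ e₂ : Site 2, IsFrame e₁ e₂ ∧ ∀ x : Site 2, |x 0 - u 0| ≤ (r : ℤ) → |x 1 - u 1| ≤ (r : ℤ) →
    (x ∈ W ↔ dotZ (x - u) e₂ ≤ 0)

/-- Sanity (non-vacuity of the local patterns): the standard frame, and the discrete lower half-plane
plus the half-row `{x₁ = 0, x₀ ≥ 0}` is a flat step at the origin at every radius. -/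
example : IsFrame ![1, 0] ![0, 1] := by
  simp [IsFrame, dotZ]

example (r : ℕ) : IsFlatStep {x : Site 2 | x 1 < 0 ∨ (x 1 = 0 ∧ 0 ≤ x 0)} 0 r := by
  refine ⟨![1, 0], ![0, 1], by simp [IsFrame, dotZ], fun x _ _ => ?_⟩
  simp [dotZ]

/-- `x` lies in the `5 × 5` lattice box about `v`. -/
def NearSite (x v : Site 2) : Prop := |x 0 - v 0| ≤ 2 ∧ |x 1 - v 1| ≤ 2

/-- ELEMENTARY MOVE 1 (vertex deletion): the discrete domains of `R'` and `R''` at mesh `δ` differ by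
exactly the vertex `v`, and their discrete arcs agree off the `5 × 5` box about `v`. The percolation
increment `ΔP` is then the one-term Russo increment at `v` (up to the local arc shift), the Green
increment is the Schur complement at `v`. -/
def IsDeletion (δ : ℝ) (R' R'' : ConformalRectangle) (v : Site 2) : Prop :=
  meshDomain R'.carrier δ = insert v (meshDomain R''.carrier δ) ∧ v ∉ meshDomain R''.carrier δ ∧
  ∀ k : Fin 4, ∀ x : Site 2, ¬ NearSite x v →
    (x ∈ discreteArc R'.carrier δ (R'.arc k) ↔ x ∈ discreteArc R''.carrier δ (R''.arc k))

/-- ELEMENTARY MOVE 2 (forward mark slide of mark `i`): same carrier; the mark vertex `m' i` moves to a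
lattice neighbour `m'' i`; on the percolation side exactly one boundary vertex, `m' i`, is transferred
from the discrete arc `i` to the discrete arc `i - 1`, all other discrete arcs unchanged. (Backward
slides are forward slides read from `R''` to `R'`.) `ΔP` is the one-term "extremal connected vertex"
increment, `ΔF` the explicit change of `η` in one mark. -/
def IsSlide (δ : ℝ) (R' R'' : ConformalRectangle) (m' m'' : Fin 4 → Site 2) (i : Fin 4) : Prop :=
  R''.carrier = R'.carrier ∧ (∀ j, j ≠ i → m'' j = m' j) ∧ (zdGraph 2).Adj (m' i) (m'' i) ∧
  m' i ∈ discreteArc R'.carrier δ (R'.arc i) ∧ m'' i ∈ discreteArc R''.carrier δ (R''.arc i) ∧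
  discreteArc R''.carrier δ (R''.arc i) = discreteArc R'.carrier δ (R'.arc i) \ {m' i} ∧
  discreteArc R''.carrier δ (R''.arc (i - 1)) = insert (m' i) (discreteArc R'.carrier δ (R'.arc (i - 1))) ∧
  ∀ k : Fin 4, k ≠ i → k ≠ i - 1 →
    discreteArc R''.carrier δ (R''.arc k) = discreteArc R'.carrier δ (R'.arc k)

/-- START of a carving chain: the discretisation of `(Q₀; μ₀)` at mesh `δ` is the image under a
lattice isometry `g` (a graph automorphism of `ℤ²`: translation ∘ dihedral map — reflections included,
so both boundary orientations are reached) of the discretisation of a Bollobás–Riordan rectangle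
`B = ((0,w)×(0,h); ih, 0, w, w + ih)` with admissible corner marks `mB` — exactly the family of the
sibling item `CardyMonotoneApproach.RectCardy`. -/
def IsBoxStart (δ : ℝ) (Q₀ : ConformalRectangle) (μ₀ : Fin 4 → Site 2) (w h : ℝ) : Prop :=
  ∃ (B : ConformalRectangle) (mB : Fin 4 → Site 2) (g : Site 2 ≃ Site 2),
    0 < w ∧ 0 < h ∧ B.carrier = Ioo (0:ℝ) w ×ℂ Ioo (0:ℝ) h ∧
    (B.pt 0 = (h:ℂ) * Complex.I ∧ B.pt 1 = 0 ∧ B.pt 2 = (w:ℂ) ∧ B.pt 3 = (w:ℂ) + (h:ℂ) * Complex.I) ∧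
    MarksNear B δ mB ∧ CleanAt B.carrier δ ∧ CleanAt Q₀.carrier δ ∧
    (∀ x y : Site 2, (zdGraph 2).Adj (g x) (g y) ↔ (zdGraph 2).Adj x y) ∧
    meshDomain Q₀.carrier δ = g '' meshDomain B.carrier δ ∧
    (∀ k : Fin 4, discreteArc Q₀.carrier δ (Q₀.arc k) = g '' discreteArc B.carrier δ (B.arc k)) ∧
    μ₀ = ⇑g ∘ mB

/-! ## §1 Statements of the line (all limits in uniform `ε–δ` form, uniform over admissible marks) -/

/-- **Kozdron–Lawler excursion modulus** (the potential-theory lemma shared with the sibling line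
`excursion-cross-ratio`): for a rectilinear conformal rectangle, uniformly over admissible mark
vertices, the discrete excursion cross-ratio of the discrete domain converges to the conformal
cross-ratio of every uniformizing datum. TRUE: Kozdron–Lawler (arXiv:math/0501189) Thm 1.1 — the
excursion Poisson kernel of every simply connected `A ⊂ ℤ²` is
`(π/2) h_A(0,x) h_A(0,y)/(1 - cos(θ_x - θ_y)) (1 + o(1))` uniformly, so in the four-point cross-ratio
the local factors (corners and corner marks included) cancel and the `(1 - cos)`-ratios give
`crossRatio²`; the passage from the killed Green function at inner vertices to the excursion kernel is
the geometric series of local returns (local factors again cancel). Uniformity over marks is free: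
finitely many admissible choices at each mesh. -/
def ExcursionModulus : Prop :=
  ∀ R : ConformalRectangle, IsRectilinear R →
    ∀ (φ : ConformalEquiv upperHalfPlaneSet R.carrier) (x : Fin 4 → ℝ), R.IsUniformizing φ x →
      ∀ β : ℝ, 0 < β → ∃ δ₀ : ℝ, 0 < δ₀ ∧ ∀ δ : ℝ, 0 < δ → δ < δ₀ →
        ∀ μ : Fin 4 → Site 2, MarksNear R δ μ → |etaMesh R δ μ - crossRatio x| ≤ β

/-- **The base family has vanishing defect**: for every Bollobás–Riordan rectangle
`B = ((0,w)×(0,h); ih, 0, w, w+ih)`, uniformly over admissible marks, `P - F(η_mesh) → 0`. PROVED below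
(`baseDefect_of_rectCardy`) from the sibling item `RectCardy` (stmt-5843: the integrable corner-marked
rectangle family, a consequence of the crux by Disproof §4) and `ExcursionModulus`. -/
def BaseDefect : Prop :=
  ∀ (B : ConformalRectangle) (w h : ℝ), 0 < w → 0 < h → B.carrier = Ioo (0:ℝ) w ×ℂ Ioo (0:ℝ) h →
    (B.pt 0 = (h:ℂ) * Complex.I ∧ B.pt 1 = 0 ∧ B.pt 2 = (w:ℂ) ∧ B.pt 3 = (w:ℂ) + (h:ℂ) * Complex.I) →
    ∀ α : ℝ, 0 < α → ∃ δ₀ : ℝ, 0 < δ₀ ∧ ∀ δ : ℝ, 0 < δ → δ < δ₀ →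
      ∀ μ : Fin 4 → Site 2, MarksNear B δ μ → |defect B δ μ| ≤ α

/-- **Box starts have vanishing defect** (the target of the hygiene stub): for fixed `w, h`, uniformly
over all chain starts `(Q₀; μ₀)` whose discretisation is a lattice-isometric image of that of a
Bollobás–Riordan rectangle `(0,w)×(0,h)` (`IsBoxStart`), the defect is small at small meshes. -/
def BoxStartDefect : Prop :=
  ∀ w h : ℝ, 0 < w → 0 < h → ∀ α : ℝ, 0 < α → ∃ δ₀ : ℝ, 0 < δ₀ ∧ ∀ δ : ℝ, 0 < δ → δ < δ₀ →
    ∀ (Q₀ : ConformalRectangle) (μ₀ : Fin 4 → Site 2), IsBoxStart δ Q₀ μ₀ w h → |defect Q₀ δ μ₀| ≤ α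

/-- **RANK-ONE WARD IDENTITY, sequential flat-step form** (the lever; triage r1-1/2/3 sharpening of the
card's `RankOneWardBox`). For every bounded region and `ε > 0`, at all small meshes: if two rectilinear
conformal rectangles with clean discretisations differ by the deletion of ONE vertex `v` which is an
`(ε/δ)`-flat STEP of the larger discrete domain, with admissible marks pairwise `ε`-apart and `ε`-far
from `v`, then the defect moves by at most `ε·(|ΔF(η)| + δ²)`: the one-term Russo increment of the
crossing probability equals the Schur-complement increment of `F(η)` to relative `o(1)`, with an
additive slack `o(δ²)` (which makes dead-end and exponentially-small regimes harmless and is summable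
over the `O(δ⁻²)` deletions of a carving). Constant `1`, no free lattice constant: in the step geometry
both sides are pinned by the exact row sum rule (`Σ` over a row sweep telescopes exactly) and the
corner-marked rectangle family. -/
def WardStepLaw : Prop :=
  ∀ K : ℝ, 0 < K → ∀ ε : ℝ, 0 < ε → ∃ δ₀ : ℝ, 0 < δ₀ ∧ ∀ δ : ℝ, 0 < δ → δ < δ₀ →
    ∀ (R' R'' : ConformalRectangle) (m : Fin 4 → Site 2) (v : Site 2),
      IsRectilinear R' → IsRectilinear R'' → CleanAt R'.carrier δ → CleanAt R''.carrier δ →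
      R'.carrier ⊆ Metric.ball (0 : ℂ) K → R''.carrier ⊆ Metric.ball (0 : ℂ) K →
      MarksNear R' δ m → MarksNear R'' δ m →
      (∀ i j : Fin 4, i ≠ j → ε ≤ dist (meshPoint δ (m i)) (meshPoint δ (m j))) →
      IsDeletion δ R' R'' v → IsFlatStep (meshDomain R'.carrier δ) v ⌈ε / δ⌉₊ →
      (∀ i : Fin 4, ε ≤ dist (meshPoint δ v) (meshPoint δ (m i))) →
        |defect R' δ m - defect R'' δ m| ≤
          ε * (|cardyFunction (etaMesh R' δ m) - cardyFunction (etaMesh R'' δ m)| + δ ^ 2)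

/-- **MARK-SLIDE LAW** (the Ward identity's twin for the other elementary move; = the integrated
one-step exit density, the (1,1,1;3) member of the route's engine in intrinsic form — triage r1-1 (i),
r1-2 (c): unavoidable for targets whose marks are not on their bounding box). Sliding mark `i` by one
lattice step along an `(ε/δ)`-flat stretch of the boundary, the other marks `ε`-far, moves the defect
by at most `ε·(|ΔF(η)| + δ)`. Constant pinned without Cardy: over a COMPLETE slide of one mark between
its two neighbours both sides telescope to exactly `1` (`P`: from `0` to `1`; `F(η)`: from `F(0⁺)` to
`F(1⁻)`), the lattice analogue of `∫ density = 1` in the route's `HalfPlaneMarkDensityLaw`. -/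
def MarkSlideLaw : Prop :=
  ∀ K : ℝ, 0 < K → ∀ ε : ℝ, 0 < ε → ∃ δ₀ : ℝ, 0 < δ₀ ∧ ∀ δ : ℝ, 0 < δ → δ < δ₀ →
    ∀ (R' R'' : ConformalRectangle) (m' m'' : Fin 4 → Site 2) (i : Fin 4),
      IsRectilinear R' → IsRectilinear R'' → CleanAt R'.carrier δ →
      R'.carrier ⊆ Metric.ball (0 : ℂ) K →
      MarksNear R' δ m' → MarksNear R'' δ m'' →
      (∀ j k : Fin 4, j ≠ k → ε ≤ dist (meshPoint δ (m' j)) (meshPoint δ (m' k))) →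
      IsSlide δ R' R'' m' m'' i → IsFlatAt (meshDomain R'.carrier δ) (m' i) ⌈ε / δ⌉₊ →
        |defect R' δ m' - defect R'' δ m''| ≤
          ε * (|cardyFunction (etaMesh R' δ m') - cardyFunction (etaMesh R'' δ m'')| + δ)

/-- **CANONICAL CARVING** (the carving lemma with its a-priori budget). For every rectilinear `R` there
are constants `C, K, c, w, h > 0` such that for every accuracy `γ > 0` there is a flatness scale
`ρ > 0` such that at all small meshes `δ` there is a finite chain `(Q k; μ k)_{k ≤ N}` of rectilinear
conformal rectangles with clean discretisations in `B(0,K)` and admissible, pairwise `c`-separated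
marks, from a lattice-isometric image of the Bollobás–Riordan box `(0,w)×(0,h)` (`IsBoxStart`) to
`(R; μ N)` itself, every step of which is either a FLAT DELETION at scale `ρ` (a `⌈ρ/δ⌉`-flat step,
`ρ`-far from the marks: the hypotheses of `WardStepLaw` for every `ε ≤ min ρ c`), a FLAT SLIDE at scale
`ρ` in either direction (hypotheses of `MarkSlideLaw`), or EXCEPTIONAL, with (i) predicted variation
plus slack of the flat steps `≤ C` (independent of `ρ`: `|Δ log η| ≲ δ²/dist(v, marks)` at flat steps is
integrable over the two-dimensional pockets) and (ii) total defect variation of the exceptional steps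
`≤ γ`. Construction (one that works; the statement does not prescribe it): take `w, h` = the
bounding-box dimensions of `Ω` plus a fixed margin and START from the image of the Bollobás–Riordan box
under a lattice isometry (translation by a vector of `δℤ²`, composed with a reflection if `∂Ω` is
clockwise) containing `Ω̄` — so `IsBoxStart` holds EXACTLY, with identical sub-lattice offsets and
closest-arc ties; decompose the annular pocket `Box ∖ Ω̄` into grid cells (extend all edges), realise
intermediate domains as `int(⋃ uncarved closed cells)` with cells = pixels extended to the box walls
(frontiers then change only at the carved cell: `IsDeletion`'s arc clause), carve cells from the box
boundary inward in an order keeping the carved region connected to the outside, sweeping each cell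
row by row as the continuation of an already carved row where possible (bulk steps are flat STEPS,
never isolated notches); keep four uncarved BRIDGES (rectilinear strips from the box sides to `∂Ω`),
slide the corner marks along the box sides onto the bridges, down the bridge sides onto `∂Ω`, carve the
bridges, and finally slide the marks along `∂Ω` to `R.pt` through cyclically ordered `c`-separated
configurations; the last step re-realises the cell polygon as `R` itself (same mesh domain and
`Ω_δ`-graph, discrete arcs equal up to `O(1)` closest-arc reassignments at the marks). EXCEPTIONAL
steps: row starts/ends and cell corners (non-flat), `ρ`-neighbourhoods of marks and of corners met by
sliding marks, momentary islands (an uncarved cell cut off from `Ω`, removed together with the last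
vertex of its neighbour to keep the discretisation clean) and the final re-realisation. (i) is a kernel
bound; (ii) is the a-priori budget: `O(ρ/δ²)` non-flat steps of size `O(δ²)` near row starts, `O(δ⁻¹)`
row ends at moving reflex corners (`Σ ≍ ρ^{1/3}` on the Green side, boundary 3-arm / RSW bounds on the
percolation side), convex corners (negligible), `ρ`-neighbourhoods of the finitely many marks and
corners (`O(ρ^{c})` by RSW continuity and Hadamard variation near a mark), finitely many islands and
one re-realisation (`o(1)` each). -/
def CanonicalCarving : Prop :=
  ∀ R : ConformalRectangle, IsRectilinear R →
    ∃ (C K c w h : ℝ), 0 < C ∧ 0 < K ∧ 0 < c ∧ 0 < w ∧ 0 < h ∧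
    ∀ γ : ℝ, 0 < γ → ∃ ρ : ℝ, 0 < ρ ∧ ∃ δ₁ : ℝ, 0 < δ₁ ∧ ∀ δ : ℝ, 0 < δ → δ < δ₁ →
      ∃ (N : ℕ) (Q : Fin (N + 1) → ConformalRectangle) (μ : Fin (N + 1) → Fin 4 → Site 2)
        (dels slides : Finset (Fin N)),
        Q (Fin.last N) = R ∧ IsBoxStart δ (Q 0) (μ 0) w h ∧
        (∀ k : Fin (N + 1), IsRectilinear (Q k) ∧ CleanAt (Q k).carrier δ ∧
          (Q k).carrier ⊆ Metric.ball (0 : ℂ) K ∧ MarksNear (Q k) δ (μ k) ∧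
          ∀ i j : Fin 4, i ≠ j → c ≤ dist (meshPoint δ (μ k i)) (meshPoint δ (μ k j))) ∧
        (∀ k : Fin N, k ∈ dels → μ k.succ = μ k.castSucc ∧
          ∃ v : Site 2, IsDeletion δ (Q k.castSucc) (Q k.succ) v ∧
            IsFlatStep (meshDomain (Q k.castSucc).carrier δ) v ⌈ρ / δ⌉₊ ∧
            ∀ i : Fin 4, ρ ≤ dist (meshPoint δ v) (meshPoint δ (μ k.castSucc i))) ∧
        (∀ k : Fin N, k ∈ slides → ∃ i : Fin 4,
          (IsSlide δ (Q k.castSucc) (Q k.succ) (μ k.castSucc) (μ k.succ) i ∧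
            IsFlatAt (meshDomain (Q k.castSucc).carrier δ) (μ k.castSucc i) ⌈ρ / δ⌉₊) ∨
          (IsSlide δ (Q k.succ) (Q k.castSucc) (μ k.succ) (μ k.castSucc) i ∧
            IsFlatAt (meshDomain (Q k.succ).carrier δ) (μ k.succ i) ⌈ρ / δ⌉₊)) ∧
        (∑ k ∈ dels, (|cardyFunction (etaMesh (Q k.castSucc) δ (μ k.castSucc)) -
            cardyFunction (etaMesh (Q k.succ) δ (μ k.succ))| + δ ^ 2) +
          ∑ k ∈ slides, (|cardyFunction (etaMesh (Q k.castSucc) δ (μ k.castSucc)) -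
            cardyFunction (etaMesh (Q k.succ) δ (μ k.succ))| + δ)) ≤ C ∧
        (∑ k ∈ (dels ∪ slides)ᶜ,
          |defect (Q k.castSucc) δ (μ k.castSucc) - defect (Q k.succ) δ (μ k.succ)|) ≤ γ

/-- **Intrinsic Cardy for rectilinear conformal rectangles** (the output of the carving, in uniform
form): at every small mesh SOME admissible choice of mark vertices has small defect. -/
def IntrinsicDefectVanishes : Prop :=
  ∀ R : ConformalRectangle, IsRectilinear R → ∀ α : ℝ, 0 < α → ∃ δ₀ : ℝ, 0 < δ₀ ∧
    ∀ δ : ℝ, 0 < δ → δ < δ₀ → ∃ μ : Fin 4 → Site 2, MarksNear R δ μ ∧ |defect R δ μ| ≤ α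

/-! ## §2 Stubs (registered; `sorry` only here) -/

/-- STUB 1 (TRUE; discrete potential theory, XL — Kozdron–Lawler arXiv:math/0501189 Thm 1.1 via a
strong-approximation coupling; shared with line `excursion-cross-ratio`). Cheapest check: the exact
linear algebra of kit j008484 (`|η_mesh - η| ≤ 10⁻³` on rectangles and L-shapes at n = 24–96). -/
theorem stub_excursionModulus : ExcursionModulus := by
  sorry

/-- STUB 2 (TRUE; exact lattice hygiene, M). `BaseDefect → BoxStartDefect`: (a) the defect of a
conformal rectangle is a function of its discrete data (mesh domain, `Ω_δ`-adjacency, discrete arcs,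
mark vertices) — `bondDomainCrossingProb = discreteCrossingProb half carrier δ (arc 0) (arc 2)` and
`etaMesh` only see these; (b) that data is transported by the graph automorphism `g` of `ℤ²`
(`IsBoxStart`), under which the product measure (`bondPercolation_real_image`) and the killed Green
function (`Matrix.inv_reindex`) are invariant; (c) for a rectangle carrier with the four corners marked
in the Bollobás–Riordan order the arcs are the four closed sides whatever the Jordan parametrisation
(so `BaseDefect`, stated per structure `B`, is uniform over the finitely many admissible corner-mark
vertices and all such `B`). -/
theorem stub_boxStartDefect : BaseDefect → BoxStartDefect := by
  sorry

/-- STUB 3 (OPEN — the lever, HARDEST). Why it might fail: it is the boundary conformal Ward identity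
of critical percolation with its sharp amplitude at one flat lattice step, finer than conformal
invariance of crossing probabilities; no engine short of a boundary stress tensor / the route's
boundary Coulomb gas is known. Why plausibly true: orders agree on both sides (`δ²`, β₃⁺ = 2
universal), the continuum shapes agree identically (rank-one kernel = `c = 0`, `h = 0` boundary Ward
kernel, triage r1-3), and in the STEP geometry the amplitude is pinned to `1` on both sides by the exact
row sum rule (triage r1-2 (b), r1-3): numerically `T_row = 1.107(12), 1.096(36), 1.060(16), 1.020(22)`
at n = 8, 12, 16, 24 (triage-2 MC, common random numbers), drifting to `1` like `0.9/n`, while the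
EXCLUDED isolated-notch ratio stays at `1.43–1.63` (kit j012026 pending for n = 32). -/
theorem stub_wardStepLaw : WardStepLaw := by
  sorry

/-- STUB 4 (OPEN; the (1,1,1;3) exit-density law of the route's engine, in integrated one-step,
intrinsic form — in content the load-bearing stub of the sibling line, here only at FLAT boundary
stretches, β₂⁺ = 1 universal gives the order `δ`). Why it might fail: a lattice-scale oscillation of
the one-step increment (cf. the route's caveat on `HalfPlaneMarkDensityLaw`) — then restate for slides
by `⌈ρ/δ⌉` steps, `ρ → 0` after `δ → 0`, without touching the line. -/
theorem stub_markSlideLaw : MarkSlideLaw := by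
  sorry

/-- STUB 5 (TRUE; combinatorial geometry of rectilinear polygons + a-priori RSW / harmonic-measure
bounds, L). The only place where the GEOMETRY of `R` is handled; produces genuine `ConformalRectangle`s
(pixel-realised intermediate polygons, Jordan by the no-hole / no-pinch carving order) so that every
probability in the line is the tree's `bondDomainCrossingProb`. -/
theorem stub_canonicalCarving : CanonicalCarving := by
  sorry

/-! ## §3 Composition (sorry-free): the carving calculus, the base, and the crux -/

/-- Flatness at a larger radius gives flatness at a smaller one. -/
theorem IsFlatStep.anti {W : Set (Site 2)} {v : Site 2} {r r' : ℕ} (h : IsFlatStep W v r)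
    (hr : r' ≤ r) : IsFlatStep W v r' := by
  obtain ⟨e₁, e₂, hf, H⟩ := h
  refine ⟨e₁, e₂, hf, fun x hx₀ hx₁ => H x (hx₀.trans ?_) (hx₁.trans ?_)⟩ <;> exact_mod_cast hr

/-- Flatness at a larger radius gives flatness at a smaller one. -/
theorem IsFlatAt.anti {W : Set (Site 2)} {u : Site 2} {r r' : ℕ} (h : IsFlatAt W u r)
    (hr : r' ≤ r) : IsFlatAt W u r' := by
  obtain ⟨e₁, e₂, hf, H⟩ := h
  refine ⟨e₁, e₂, hf, fun x hx₀ hx₁ => H x (hx₀.trans ?_) (hx₁.trans ?_)⟩ <;> exact_mod_cast hr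

/-- Telescoping along a finite chain: the end-to-start difference is bounded by the sum of the
absolute step increments. -/
theorem abs_sub_le_sum_steps {N : ℕ} (f : Fin (N + 1) → ℝ) :
    |f (Fin.last N) - f 0| ≤ ∑ k : Fin N, |f k.castSucc - f k.succ| := by
  let g : ℕ → ℝ := fun n => if h : n < N + 1 then f ⟨n, h⟩ else 0
  have hg : ∀ (n : ℕ) (hn : n < N + 1), g n = f ⟨n, hn⟩ := fun n hn => dif_pos hn
  have h1 : f (Fin.last N) - f 0 = ∑ i ∈ Finset.range N, (g (i + 1) - g i) := by
    rw [Finset.sum_range_sub, hg N (Nat.lt_succ_self N), hg 0 (Nat.succ_pos N)]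
    rfl
  have h2 : ∑ k : Fin N, |f k.castSucc - f k.succ| = ∑ i ∈ Finset.range N, |g (i + 1) - g i| := by
    rw [← Fin.sum_univ_eq_sum_range (fun i => |g (i + 1) - g i|) N]
    refine Finset.sum_congr rfl fun k _ => ?_
    rw [hg k (by omega), hg (k + 1) (by omega), abs_sub_comm]
    rfl
  rw [h1, h2]
  exact Finset.abs_sum_le_sum_abs _ _

/-- **THE CARVING CALCULUS (proved).** Box starts with vanishing defect, the two local laws and the
canonical carving give intrinsic Cardy for every rectilinear conformal rectangle. For accuracy `α`:
take the chains at budget `γ = α/4` and flatness scale `ρ`; apply the laws at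
`ε = min (α/(4C)) (min ρ c)` (flat at radius `⌈ρ/δ⌉` ⇒ flat at radius `⌈ε/δ⌉`; separation `c` and
distance `ρ` dominate `ε`); telescope:
`|defect R| ≤ |defect (Q 0)| + ε·C + γ ≤ α/4 + α/4 + α/4`. This is the triage-verified implication
"C⁺ ⟹ IntrinsicCardy(polyominoes) by carving + telescoping, given uniformity", kernel-checked. -/
theorem carvingTransfer (hB : BoxStartDefect) (hW : WardStepLaw) (hS : MarkSlideLaw)
    (hC : CanonicalCarving) : IntrinsicDefectVanishes := by
  intro R hR α hα
  obtain ⟨C, K, c, w, h, hC0, hK0, hc0, hw0, hh0, hγ⟩ := hC R hR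
  obtain ⟨ρ, hρ0, δ₁, hδ₁0, hchain⟩ := hγ (α / 4) (by positivity)
  set ε : ℝ := min (α / (4 * C)) (min ρ c) with hε_def
  have hε0 : 0 < ε := lt_min (by positivity) (lt_min hρ0 hc0)
  have hερ : ε ≤ ρ := (min_le_right _ _).trans (min_le_left _ _)
  have hεc : ε ≤ c := (min_le_right _ _).trans (min_le_right _ _)
  have hεC : ε * C ≤ α / 4 := by
    have : ε ≤ α / (4 * C) := min_le_left _ _
    calc ε * C ≤ α / (4 * C) * C := by gcongr
      _ = α / 4 := by field_simp
  obtain ⟨δW, hδW0, hWlaw⟩ := hW K hK0 ε hε0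
  obtain ⟨δS, hδS0, hSlaw⟩ := hS K hK0 ε hε0
  obtain ⟨δB, hδB0, hBase⟩ := hB w h hw0 hh0 (α / 4) (by positivity)
  refine ⟨min (min δ₁ δW) (min δS δB), lt_min (lt_min hδ₁0 hδW0) (lt_min hδS0 hδB0),
    fun δ hδ0 hδlt => ?_⟩
  have hδ1 : δ < δ₁ := hδlt.trans_le ((min_le_left _ _).trans (min_le_left _ _))
  have hδW : δ < δW := hδlt.trans_le ((min_le_left _ _).trans (min_le_right _ _))
  have hδS : δ < δS := hδlt.trans_le ((min_le_right _ _).trans (min_le_left _ _))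
  have hδB : δ < δB := hδlt.trans_le ((min_le_right _ _).trans (min_le_right _ _))
  obtain ⟨N, Q, μ, dels, slides, hlast, hstart, hall, hdels, hslides, hvar, hexc⟩ :=
    hchain δ hδ0 hδ1
  have hrad : ⌈ε / δ⌉₊ ≤ ⌈ρ / δ⌉₊ := Nat.ceil_mono (div_le_div_of_nonneg_right hερ hδ0.le)
  -- the step increments
  set b : Fin N → ℝ := fun k => |defect (Q k.castSucc) δ (μ k.castSucc) - defect (Q k.succ) δ (μ k.succ)|
    with hb_def
  have hb0 : ∀ k, 0 ≤ b k := fun k => abs_nonneg _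
  -- flat deletions
  have hdel : ∀ k ∈ dels, b k ≤ ε * (|cardyFunction (etaMesh (Q k.castSucc) δ (μ k.castSucc)) -
      cardyFunction (etaMesh (Q k.succ) δ (μ k.succ))| + δ ^ 2) := by
    intro k hk
    obtain ⟨hμ, v, hD, hF, hfar⟩ := hdels k hk
    obtain ⟨hr1, hcl1, hball1, hm1, hsep1⟩ := hall k.castSucc
    obtain ⟨hr2, hcl2, hball2, hm2, -⟩ := hall k.succ
    rw [hμ] at hm2
    have key := hWlaw δ hδ0 hδW (Q k.castSucc) (Q k.succ) (μ k.castSucc) v hr1 hr2 hcl1 hcl2 hball1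
      hball2 hm1 hm2 (fun i j hij => hεc.trans (hsep1 i j hij)) hD (hF.anti hrad)
      (fun i => hερ.trans (hfar i))
    simp only [hb_def, hμ]
    simpa [hμ] using key
  -- flat slides
  have hsl : ∀ k ∈ slides, b k ≤ ε * (|cardyFunction (etaMesh (Q k.castSucc) δ (μ k.castSucc)) -
      cardyFunction (etaMesh (Q k.succ) δ (μ k.succ))| + δ) := by
    intro k hk
    obtain ⟨i, hcase⟩ := hslides k hk
    obtain ⟨hr1, hcl1, hball1, hm1, hsep1⟩ := hall k.castSucc
    obtain ⟨hr2, hcl2, hball2, hm2, hsep2⟩ := hall k.succ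
    rcases hcase with ⟨hSl, hFl⟩ | ⟨hSl, hFl⟩
    · exact hSlaw δ hδ0 hδS (Q k.castSucc) (Q k.succ) (μ k.castSucc) (μ k.succ) i hr1 hr2 hcl1 hball1
        hm1 hm2 (fun j l hjl => hεc.trans (hsep1 j l hjl)) hSl (hFl.anti hrad)
    · have key := hSlaw δ hδ0 hδS (Q k.succ) (Q k.castSucc) (μ k.succ) (μ k.castSucc) i hr2 hr1 hcl2
        hball2 hm2 hm1 (fun j l hjl => hεc.trans (hsep2 j l hjl)) hSl (hFl.anti hrad)
      simp only [hb_def]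
      rw [abs_sub_comm]
      refine key.trans (le_of_eq ?_)
      rw [abs_sub_comm]
  -- summing up
  have hsum_dels : ∑ k ∈ dels, b k ≤ ε * ∑ k ∈ dels,
      (|cardyFunction (etaMesh (Q k.castSucc) δ (μ k.castSucc)) -
        cardyFunction (etaMesh (Q k.succ) δ (μ k.succ))| + δ ^ 2) := by
    rw [Finset.mul_sum]; exact Finset.sum_le_sum hdel
  have hsum_slides : ∑ k ∈ slides, b k ≤ ε * ∑ k ∈ slides,
      (|cardyFunction (etaMesh (Q k.castSucc) δ (μ k.castSucc)) -
        cardyFunction (etaMesh (Q k.succ) δ (μ k.succ))| + δ) := by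
    rw [Finset.mul_sum]; exact Finset.sum_le_sum hsl
  have hsum_flat : ∑ k ∈ dels ∪ slides, b k ≤ ε * C := by
    have hui : ∑ k ∈ dels ∪ slides, b k ≤ ∑ k ∈ dels, b k + ∑ k ∈ slides, b k := by
      rw [← Finset.sum_union_inter]
      exact le_add_of_nonneg_right (Finset.sum_nonneg fun k _ => hb0 k)
    refine hui.trans ((add_le_add hsum_dels hsum_slides).trans ?_)
    rw [← mul_add]
    exact mul_le_mul_of_nonneg_left hvar hε0.le
  have hsum_all : ∑ k, b k ≤ ε * C + α / 4 := by
    rw [← Finset.sum_add_sum_compl (dels ∪ slides) b]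
    exact add_le_add hsum_flat hexc
  have htel : |defect (Q (Fin.last N)) δ (μ (Fin.last N)) - defect (Q 0) δ (μ 0)| ≤ ∑ k, b k :=
    abs_sub_le_sum_steps (fun k => defect (Q k) δ (μ k))
  have hbase : |defect (Q 0) δ (μ 0)| ≤ α / 4 := hBase δ hδ0 hδB (Q 0) (μ 0) hstart
  refine ⟨μ (Fin.last N), ?_, ?_⟩
  · have := (hall (Fin.last N)).2.2.2.1
    rwa [hlast] at this
  · rw [← hlast]
    calc |defect (Q (Fin.last N)) δ (μ (Fin.last N))|
        ≤ |defect (Q (Fin.last N)) δ (μ (Fin.last N)) - defect (Q 0) δ (μ 0)| +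
            |defect (Q 0) δ (μ 0)| := by
          have := abs_add_le (defect (Q (Fin.last N)) δ (μ (Fin.last N)) - defect (Q 0) δ (μ 0))
            (defect (Q 0) δ (μ 0))
          rwa [sub_add_cancel] at this
      _ ≤ (ε * C + α / 4) + α / 4 := add_le_add (htel.trans hsum_all) hbase
      _ ≤ α / 4 + α / 4 + α / 4 := by linarith
      _ ≤ α := by linarith

/-- From a crossing LIMIT and the uniform excursion modulus, the defect is uniformly small
(used for the base family). -/
theorem defect_small_of_tendsto {R : ConformalRectangle} {η : ℝ} (hη : η ∈ Ioo (0 : ℝ) 1)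
    (hP : Tendsto (bondDomainCrossingProb R) (𝓝[>] 0) (𝓝 (cardyFunction η)))
    (hKL : ∀ β : ℝ, 0 < β → ∃ δ₀ : ℝ, 0 < δ₀ ∧ ∀ δ : ℝ, 0 < δ → δ < δ₀ →
      ∀ μ : Fin 4 → Site 2, MarksNear R δ μ → |etaMesh R δ μ - η| ≤ β) :
    ∀ α : ℝ, 0 < α → ∃ δ₀ : ℝ, 0 < δ₀ ∧ ∀ δ : ℝ, 0 < δ → δ < δ₀ →
      ∀ μ : Fin 4 → Site 2, MarksNear R δ μ → |defect R δ μ| ≤ α := by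
  intro α hα
  have hcont : ContinuousAt cardyFunction η :=
    continuousOn_cardyFunction_Ioo.continuousAt (Ioo_mem_nhds hη.1 hη.2)
  obtain ⟨β, hβ0, hβ⟩ := Metric.continuousAt_iff.1 hcont (α / 2) (by positivity)
  obtain ⟨δK, hδK0, hK⟩ := hKL (β / 2) (by positivity)
  obtain ⟨δP, hδP0, hPε⟩ := Metric.tendsto_nhdsWithin_nhds.1 hP (α / 2) (by positivity)
  refine ⟨min δK δP, lt_min hδK0 hδP0, fun δ hδ0 hδlt μ hμ => ?_⟩
  have h1 : |etaMesh R δ μ - η| ≤ β / 2 := hK δ hδ0 (hδlt.trans_le (min_le_left _ _)) μ hμ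
  have h2 : dist (cardyFunction (etaMesh R δ μ)) (cardyFunction η) < α / 2 :=
    hβ (by rw [Real.dist_eq]; linarith)
  have h3 : dist (bondDomainCrossingProb R δ) (cardyFunction η) < α / 2 :=
    hPε hδ0 (by rw [Real.dist_eq, sub_zero, abs_of_pos hδ0]; exact hδlt.trans_le (min_le_right _ _))
  rw [Real.dist_eq] at h2 h3
  have : defect R δ μ = (bondDomainCrossingProb R δ - cardyFunction η) -
      (cardyFunction (etaMesh R δ μ) - cardyFunction η) := by
    simp only [defect]; ring
  rw [this]
  exact (abs_sub _ _).trans (by linarith)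

/-- From uniformly small defects (for SOME admissible marks) and the uniform excursion modulus, the
crossing probabilities CONVERGE to `F(η)` (used for the target). -/
theorem tendsto_of_defect_small {R : ConformalRectangle} {η : ℝ} (hη : η ∈ Ioo (0 : ℝ) 1)
    (hD : ∀ α : ℝ, 0 < α → ∃ δ₀ : ℝ, 0 < δ₀ ∧ ∀ δ : ℝ, 0 < δ → δ < δ₀ →
      ∃ μ : Fin 4 → Site 2, MarksNear R δ μ ∧ |defect R δ μ| ≤ α)
    (hKL : ∀ β : ℝ, 0 < β → ∃ δ₀ : ℝ, 0 < δ₀ ∧ ∀ δ : ℝ, 0 < δ → δ < δ₀ →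
      ∀ μ : Fin 4 → Site 2, MarksNear R δ μ → |etaMesh R δ μ - η| ≤ β) :
    Tendsto (bondDomainCrossingProb R) (𝓝[>] 0) (𝓝 (cardyFunction η)) := by
  rw [Metric.tendsto_nhdsWithin_nhds]
  intro α hα
  have hcont : ContinuousAt cardyFunction η :=
    continuousOn_cardyFunction_Ioo.continuousAt (Ioo_mem_nhds hη.1 hη.2)
  obtain ⟨β, hβ0, hβ⟩ := Metric.continuousAt_iff.1 hcont (α / 3) (by positivity)
  obtain ⟨δK, hδK0, hK⟩ := hKL (β / 2) (by positivity)
  obtain ⟨δD, hδD0, hDα⟩ := hD (α / 3) (by positivity)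
  refine ⟨min δK δD, lt_min hδK0 hδD0, fun {δ} hδ0 hδlt => ?_⟩
  rw [mem_Ioi] at hδ0
  rw [Real.dist_eq, sub_zero, abs_of_pos hδ0] at hδlt
  obtain ⟨μ, hμ, hdef⟩ := hDα δ hδ0 (hδlt.trans_le (min_le_right _ _))
  have h1 : |etaMesh R δ μ - η| ≤ β / 2 := hK δ hδ0 (hδlt.trans_le (min_le_left _ _)) μ hμ
  have h2 : dist (cardyFunction (etaMesh R δ μ)) (cardyFunction η) < α / 3 :=
    hβ (by rw [Real.dist_eq]; linarith)
  rw [Real.dist_eq] at h2 ⊢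
  have : bondDomainCrossingProb R δ - cardyFunction η =
      defect R δ μ + (cardyFunction (etaMesh R δ μ) - cardyFunction η) := by
    simp only [defect]; ring
  rw [this]
  exact (abs_add_le _ _).trans_lt (by linarith)

/-- **Base**: the sibling item `RectCardy` (Cardy for Bollobás–Riordan corner-marked rectangles,
stmt-CriticalPhenomena-5843 — the integrable Kleban–Zagier family; a CONSEQUENCE of the crux by
Disproof §4 `rectCardy_of_crux`) and the Kozdron–Lawler modulus give vanishing defect on the base
family. -/
theorem baseDefect_of_rectCardy (hRect : RectCardy) (hKL : ExcursionModulus) : BaseDefect := by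
  intro B w h hw hh hcar hpt
  obtain ⟨φ, x, hφx⟩ := MarkedDomain.exists_isUniformizing_holds B
  exact defect_small_of_tendsto (ConformalRectangle.crossRatio_mem_Ioo_of_isUniformizing hφx)
    (hRect B w h hw hh hcar hpt φ x hφx) (hKL B (isRectilinear_of_carrier_eq hw hh hcar) φ x hφx)

/-- **`RectilinearCardy` from the stubs, given the rectangle base `RectCardy`.** For a rectilinear `R`
and a uniformizing datum `(φ, x)`: the carving calculus (`carvingTransfer`, fed by the base through
the hygiene stub, the two laws and the carving) gives admissible marks with uniformly small defect;
Kozdron–Lawler (stub 1) gives `η_mesh → crossRatio x ∈ (0,1)` uniformly; continuity of `F` there gives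
`P_δ → F(crossRatio x)`, i.e. `R.HasCrossingLimit (bondDomainCrossingProb R) cardyFunction` at this
datum. Concludes the crux BY NAME. -/
theorem RectilinearCardy_of (hRect : RectCardy) : RectilinearCardy := by
  rw [rectilinearCardy_iff]
  intro R hR φ x hφx
  have hI : IntrinsicDefectVanishes :=
    carvingTransfer (stub_boxStartDefect (baseDefect_of_rectCardy hRect stub_excursionModulus))
      stub_wardStepLaw stub_markSlideLaw stub_canonicalCarving
  exact tendsto_of_defect_small (ConformalRectangle.crossRatio_mem_Ioo_of_isUniformizing hφx)
    (hI R hR) (stub_excursionModulus R hR φ x hφx)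

end Summit.CriticalPhenomena.CardyFormulaZ2.Cruxes.RectilinearCardy.RankOneWardCarving

end
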